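import Mathlib
import HarnessLib
import Summits.ResolutionOfSingularities.ResolutionOfSingularities.Theorems.WildQuotientsWildQuotientResolutionS1aOrbitRule

/-!
# S1a — MODELS REACHABLE BY AUX MOVES ONLY: the strategy never blows up a non-principal centre through a good point, so both research stubs need
# only hold on `ReachableAux` models (weaker by a theorem)

[OURS · L1 W4.5c · lead-1 g9] — NOT statements of the manuscript; counted 0; AI-level work, weaker than expert review. Crux
stmt-ResolutionOfSingularities-17941, line `s1a-logminvertex` v9 → v10 (lead reshape). Route-independent.

Every centre the two-phase strategy ever blows up is an AUX centre (`IsAuxCentre … (badLocus)ᶜ`: admissible, and principal-or-idle at the GOOD points):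
principal centres in the KILL branch (`isAuxCentre_of_isPrincipalCentre`), aux centres in both AUX branches. Hence the invariant class `P` of the winning
induction may be taken to be the models reachable from the initial model by AUX MOVES ONLY — a smaller class than `Reachable` (arbitrary admissible
moves may blow up weighted centres through good points and spoil them). The research stubs restricted to this class are WEAKER BY A THEOREM.
* `GameFrame.GModel.ReachableAux M₀ M` (inductive), `reachable_of_reachableAux`;
* ★★ `GameFrame.GModel.wins_of_touchOrTopOrOrbitSeq_aux` — the nested induction of `…S1aOrbitRule` with the class `P` required to be stable under AUX
  moves only;
* research statements `KillTouchReachAux p`, `AuxWithinReachAux p` (the registered v9 statements with `Reachable` replaced by `ReachableAux`),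
  `killTouchReachAux_of_killTouchReach`, `auxWithinReachAux_of_auxWithinReach` (weaker by a theorem).
The `Theses`-cone wrapper is `…S1aWinsOfAuxReachRule`.
-/

set_option linter.dupNamespace false

noncomputable section

open CategoryTheory Limits AlgebraicGeometry TopologicalSpace Topology
open Literature.AlgebraicGeometry.Resolution Literature.AlgebraicGeometry.RelativeSpec
open Summit.ResolutionOfSingularities.ResolutionOfSingularities.Theorems.WildQuotientResolution.S1
open Summit.ResolutionOfSingularities.ResolutionOfSingularities.Theorems.WildQuotientResolution.S1.NodeAtlas
open Summit.ResolutionOfSingularities.ResolutionOfSingularities.Theorems.WildQuotientResolution.S1.G1Proof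
open Summit.ResolutionOfSingularities.ResolutionOfSingularities.Theorems.WildQuotientResolution.S1.CompCount
open Summit.ResolutionOfSingularities.ResolutionOfSingularities.Theorems.WildQuotientResolution.S1.TopComponents

namespace Summit.ResolutionOfSingularities.ResolutionOfSingularities.Theorems.WildQuotientResolution.S1

namespace GameFrame.GModel

variable {p : ℕ} {X' X₁ : Scheme.{0}} {q : X' ⟶ X₁} {G : Type} [Group G] {ρ : G →* Aut X'} {g₀ : G}

/-- **`ReachableAux M₀ M`**: `M` is obtained from `M₀` by finitely many AUX moves — blow-ups of AUX centres (admissible, principal-or-idle at the good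
points; every principal centre is one). The class of models the two-phase strategy actually visits. [OURS · L1 W4.5c] -/
inductive ReachableAux (M₀ : GModel p q G ρ g₀) : GModel p q G ρ g₀ → Prop
  | refl : ReachableAux M₀ M₀
  | move {M M' : GModel p q G ρ g₀} (𝒦 : ReesFiltration M.V) (d : ℕ) :
      ReachableAux M₀ M → IsAuxCentre p M.act g₀ 𝒦 d (M.badLocus)ᶜ → M.IsMoveOf M' 𝒦 d → ReachableAux M₀ M'

/-- Aux-reachable models are reachable. -/
theorem reachable_of_reachableAux {M₀ M : GModel p q G ρ g₀} (h : M₀.ReachableAux M) : M₀.Reachable M := by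
  induction h with
  | refl => exact Reachable.refl
  | move 𝒦 d _ haux hmv ih => exact Reachable.move 𝒦 d ih haux.1 hmv

/-- ★★ **TOUCH-KILL ∨ bounded AUX-TOP ∨ bounded AUX-ORBIT sequence WINS, for a class stable under AUX moves only.** As `wins_of_touchOrTopOrOrbitSeq`
(p622502), but `P` is only required to be preserved by moves along AUX centres — which is all the strategy uses. [OURS · L1 W4.5c] -/
theorem wins_of_touchOrTopOrOrbitSeq_aux [Finite G] (hp : p.Prime) (hG : ∀ g : G, g ∈ Subgroup.zpowers g₀) (P : GModel p q G ρ g₀ → Prop)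
    (hPmove : ∀ (M M' : GModel p q G ρ g₀) (𝒦 : ReesFiltration M.V) (d : ℕ),
      P M → IsAuxCentre p M.act g₀ 𝒦 d (M.badLocus)ᶜ → M.IsMoveOf M' 𝒦 d → P M')
    (hB : ∀ M : GModel p q G ρ g₀, P M → M.HasNoetherianBase) (hnu : ∀ M : GModel p q G ρ g₀, P M → ∃ n : ℕ, M.nu1 < n)
    (hcpt : ∀ M : GModel p q G ρ g₀, P M → CompactSpace M.V)
    (H : ∀ M : GModel p q G ρ g₀, P M → ¬ M.Terminal →
      (M.jInf = ⊥ ∧ ∃ (𝒦 : ReesFiltration M.V) (d : ℕ), IsPrincipalCentre p M.act g₀ 𝒦 d ∧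
        (M.badLocus ∩ ((𝒦.ideal d).support : Set M.V)).Nonempty) ∨
      (∃ n : ℕ, AuxAltWithin n M) ∨ (∃ n : ℕ, AuxOrbitWithin n M))
    (M₀ : GModel p q G ρ g₀) (hP₀ : P M₀) : Wins p q G ρ g₀ M₀ := by
  have hfin : ∀ M : GModel p q G ρ g₀, P M → (irreducibleComponents ↥M.badLocus).Finite := fun M hPM => by
    haveI := hcpt M hPM
    exact M.finite_irreducibleComponents_badLocus
  obtain ⟨n₀, hn₀⟩ := hnu M₀ hP₀
  suffices main : ∀ (a : ℕ) (M : GModel p q G ρ g₀), P M → M.jInf < a → Wins p q G ρ g₀ M from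
    main n₀ M₀ hP₀ (lt_of_le_of_lt M₀.jInf_le_nu1 hn₀)
  intro a
  induction a using Nat.strong_induction_on with
  | _ a iha =>
    have drop : ∀ M M' : GModel p q G ρ g₀, P M' → M.jInf < a → M'.jInf < M.jInf → Wins p q G ρ g₀ M' := fun M M' hP' ha hj => by
      cases a with
      | zero => exact absurd (withBot_eq_bot_of_lt_zero ha ▸ hj) not_lt_bot
      | succ a' => exact iha a' (Nat.lt_succ_self a') M' hP' (lt_of_lt_of_le hj (withBot_le_of_lt_succ ha))
    have seqTop : ∀ (n : ℕ) (M : GModel p q G ρ g₀), P M → M.jInf < a → AuxAltWithin n M → Wins p q G ρ g₀ M := by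
      intro n
      induction n with
      | zero =>
        intro M hPM ha h
        obtain ⟨𝒦, d, haux, hmoves⟩ := h
        exact Wins.of_moves 𝒦 d haux.1 fun M' hmv => drop M M' (hPmove M M' 𝒦 d hPM haux hmv) ha (hmoves M' hmv)
      | succ n ihn =>
        intro M hPM ha h
        rcases h with h | ⟨𝒦, d, haux, hmoves⟩
        · obtain ⟨𝒦, d, haux, hmoves⟩ := h
          exact Wins.of_moves 𝒦 d haux.1 fun M' hmv => drop M M' (hPmove M M' 𝒦 d hPM haux hmv) ha (hmoves M' hmv)
        · exact Wins.of_moves 𝒦 d haux.1 fun M' hmv =>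
            ihn M' (hPmove M M' 𝒦 d hPM haux hmv) (lt_of_le_of_lt (hmoves M' hmv).1 ha) (hmoves M' hmv).2
    have level : ∀ (b : ℕ) (M : GModel p q G ρ g₀), P M → M.jInf < a → M.topCount < b → Wins p q G ρ g₀ M := by
      intro b
      induction b with
      | zero => exact fun M _ _ hb => absurd hb (Nat.not_lt_zero _)
      | succ b ihb =>
        have orbAt : ∀ M : GModel p q G ρ g₀, P M → M.jInf < a → M.topCount ≤ b → M.AuxOrbitAt → Wins p q G ρ g₀ M := by
          intro M hPM ha hb h
          haveI := hcpt M hPM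
          have hne : M.jInf ≠ ⊥ := by
            obtain ⟨-, -, -, ⟨t, ht, -, -⟩, -⟩ := h
            intro hbot
            rw [jInf, topologicalKrullDim, Order.krullDim_eq_bot_iff] at hbot
            obtain ⟨x, -⟩ := ht.1.nonempty
            exact hbot.elim ⟨closure {x}, isIrreducible_singleton.closure, isClosed_closure⟩
          obtain ⟨k, hk⟩ := exists_nat_eq_of_ne_bot_of_lt hne ha
          obtain ⟨𝒦, d, haux, hmoves⟩ := lex_lt_of_move_of_auxOrbitAt hp hG M (hB M hPM) hk h
          refine Wins.of_moves 𝒦 d haux.1 fun M' hmv => ?_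
          have hPM' := hPmove M M' 𝒦 d hPM haux hmv
          rcases hmoves M' hmv with hlt | ⟨heq, hlt⟩
          · exact drop M M' hPM' ha hlt
          · exact ihb M' hPM' (heq ▸ ha) (lt_of_lt_of_le hlt hb)
        have seqOrb : ∀ (n : ℕ) (M : GModel p q G ρ g₀), P M → M.jInf < a → M.topCount ≤ b → AuxOrbitWithin n M → Wins p q G ρ g₀ M := by
          intro n
          induction n with
          | zero => exact fun M hPM ha hb h => orbAt M hPM ha hb h
          | succ n ihn =>
            intro M hPM ha hb h
            rcases h with h | ⟨𝒦, d, haux, hmoves⟩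
            · exact orbAt M hPM ha hb h
            · refine Wins.of_moves 𝒦 d haux.1 fun M' hmv => ?_
              have hPM' := hPmove M M' 𝒦 d hPM haux hmv
              obtain ⟨hlex, hwithin⟩ := hmoves M' hmv
              rcases hlex with hlt | ⟨heq, hle⟩
              · exact drop M M' hPM' ha hlt
              · exact ihn M' hPM' (heq ▸ ha) (hle.trans hb) hwithin
        have kill : ∀ (c : ℕ) (M : GModel p q G ρ g₀), P M → M.jInf < a → M.topCount ≤ b → nIrrComp ↥M.badLocus < c →
            Wins p q G ρ g₀ M := by
          intro c
          induction c with
          | zero => exact fun M _ _ _ hc => absurd hc (Nat.not_lt_zero _)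
          | succ c ihc =>
            intro M hPM ha hb hc
            by_cases hT : M.Terminal
            · exact Wins.terminal M hT
            rcases H M hPM hT with ⟨hbot, 𝒦, d, hprin, htouch⟩ | ⟨n, hn⟩ | ⟨n, hn⟩
            · refine Wins.of_moves 𝒦 d (isAdmissibleCentre_of_isPrincipalCentre hprin) fun M' hmv => ?_
              have hPM' := hPmove M M' 𝒦 d hPM (isAuxCentre_of_isPrincipalCentre hprin _) hmv
              have hj : M'.jInf ≤ M.jInf := jInf_move_le hp hG M M' 𝒦 d hprin (hB M hPM) hmv
              have hbot' : M'.jInf = ⊥ := le_bot_iff.mp (hbot ▸ hj)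
              exact ihc M' hPM' (lt_of_le_of_lt hj ha) (by rw [M'.topCount_eq_zero_of_jInf_eq_bot hbot']; exact Nat.zero_le _)
                (lt_of_lt_of_le (nIrrComp_badLocus_principalMove_lt hp hG M M' 𝒦 d hprin (hB M hPM) (hfin M hPM) htouch hmv)
                  (Nat.lt_succ_iff.mp hc))
            · exact seqTop n M hPM ha hn
            · exact seqOrb n M hPM ha hb hn
        intro M hPM ha hb
        exact kill (nIrrComp ↥M.badLocus + 1) M hPM ha (Nat.lt_succ_iff.mp hb) (Nat.lt_succ_self _)
    intro M hPM ha
    exact level (M.topCount + 1) M hPM ha (Nat.lt_succ_self _)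

end GameFrame.GModel

/-! ## The research statements on aux-reachable models -/

/-- **`KillTouchReachAux p`**: `KillTouchReach p` (registered v8/v9) restricted to the models reachable from the initial model by AUX MOVES ONLY
(`ReachableAux`). Weaker by a theorem (`killTouchReachAux_of_killTouchReach`). [OURS · L1 W4.5c · CANDIDATE, asserted nowhere] -/
def KillTouchReachAux (p : ℕ) : Prop :=
  ∀ (k : Type) [Field k] [CharP k p] [PerfectField k] (X' X₁ : Scheme.{0})
    (f : X₁ ⟶ Spec (.of k)) (q : X' ⟶ X₁) (G : Type) [Group G] [Finite G]
    (ρ : G →* Aut X'), Nat.card G = p → IsSeparated f → LocallyOfFiniteType f → QuasiCompact f →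
    IsIntegral X₁ → ∀ [IsIntegral X'], Scheme.IsRegular X' → IsFinite q → Function.Surjective q.base →
    (∃ U : X₁.Opens, Dense (U : Set X₁) ∧ Etale (q ∣_ U)) →
    ∀ (hq : ∀ g : G, (ρ g).hom ≫ q = q),
    (∀ x y : X', q.base x = q.base y → ∃ g : G, (ρ g).hom.base x = y) →
    topologicalKrullDim X₁ ≤ 4 → Function.Injective ρ →
    ∀ (g₀ : G), (∀ g : G, g ∈ Subgroup.zpowers g₀) → ∀ [IsLocallyNoetherian X']
      (h₀ : NodeAtlas p (⟨ρ, hq⟩ : ActionOver q G) g₀),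
      ∀ M : GameFrame.GModel p q G ρ g₀, (GameFrame.GModel.initial hq h₀).ReachableAux M → ¬ M.Terminal → M.jInf = ⊥ →
        ∃ (𝒦 : ReesFiltration M.V) (d : ℕ), IsPrincipalCentre p M.act g₀ 𝒦 d ∧
          (M.badLocus ∩ ((𝒦.ideal d).support : Set M.V)).Nonempty

/-- **`AuxWithinReachAux p`**: `AuxWithinReach p` (registered v9) restricted to the models reachable by AUX MOVES ONLY. Weaker by a theorem
(`auxWithinReachAux_of_auxWithinReach`). [OURS · L1 W4.5c · CANDIDATE, asserted nowhere] -/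
def AuxWithinReachAux (p : ℕ) : Prop :=
  ∀ (k : Type) [Field k] [CharP k p] [PerfectField k] (X' X₁ : Scheme.{0})
    (f : X₁ ⟶ Spec (.of k)) (q : X' ⟶ X₁) (G : Type) [Group G] [Finite G]
    (ρ : G →* Aut X'), Nat.card G = p → IsSeparated f → LocallyOfFiniteType f → QuasiCompact f →
    IsIntegral X₁ → ∀ [IsIntegral X'], Scheme.IsRegular X' → IsFinite q → Function.Surjective q.base →
    (∃ U : X₁.Opens, Dense (U : Set X₁) ∧ Etale (q ∣_ U)) →
    ∀ (hq : ∀ g : G, (ρ g).hom ≫ q = q),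
    (∀ x y : X', q.base x = q.base y → ∃ g : G, (ρ g).hom.base x = y) →
    topologicalKrullDim X₁ ≤ 4 → Function.Injective ρ →
    ∀ (g₀ : G), (∀ g : G, g ∈ Subgroup.zpowers g₀) → ∀ [IsLocallyNoetherian X']
      (h₀ : NodeAtlas p (⟨ρ, hq⟩ : ActionOver q G) g₀),
      ∀ M : GameFrame.GModel p q G ρ g₀, (GameFrame.GModel.initial hq h₀).ReachableAux M → ¬ M.Terminal →
        M.jInf ≠ ⊥ → (∃ n : ℕ, GameFrame.GModel.AuxTopWithin n M) ∨ (∃ n : ℕ, GameFrame.GModel.AuxOrbitWithin n M)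

/-- Weaker by a theorem: `KillTouchReach p ⇒ KillTouchReachAux p`. [OURS · L1 W4.5c] -/
theorem killTouchReachAux_of_killTouchReach {p : ℕ} (h : KillTouchReach p) : KillTouchReachAux p := by
  intro k _ _ _ X' X₁ f q G _ _ ρ hG hfs hflft hfqc hX₁ _ hreg hqfin hqsurj hU hq horb hdim hinj g₀ hg₀ _ h₀ M hM hT hj
  exact h k X' X₁ f q G ρ hG hfs hflft hfqc hX₁ hreg hqfin hqsurj hU hq horb hdim hinj g₀ hg₀ h₀ M
    (GameFrame.GModel.reachable_of_reachableAux hM) hT hj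

/-- Weaker by a theorem: `AuxWithinReach p ⇒ AuxWithinReachAux p`. [OURS · L1 W4.5c] -/
theorem auxWithinReachAux_of_auxWithinReach {p : ℕ} (h : AuxWithinReach p) : AuxWithinReachAux p := by
  intro k _ _ _ X' X₁ f q G _ _ ρ hG hfs hflft hfqc hX₁ _ hreg hqfin hqsurj hU hq horb hdim hinj g₀ hg₀ _ h₀ M hM hT hj
  exact h k X' X₁ f q G ρ hG hfs hflft hfqc hX₁ hreg hqfin hqsurj hU hq horb hdim hinj g₀ hg₀ h₀ M
    (GameFrame.GModel.reachable_of_reachableAux hM) hT hj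

end Summit.ResolutionOfSingularities.ResolutionOfSingularities.Theorems.WildQuotientResolution.S1

end
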